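import Literature.NumberTheory.Transcendental.KZLogCalculusProofs
import Literature.NumberTheory.Transcendental.KZTorusLogRep

/-!
# One-variable atoms for item ClausenPiVanishes: `h = 1/(1+t²)`, `|1 ∓ e(t)|²`, integrability

Helpers for route item ClausenPiVanishes (stmt-KontsevichZagierPeriods-5202) of route
KontsevichZagierPeriods/K2SymbolChains, on `ℝ¹ = (Fin 1 → ℝ)`: the torus data of
`KZTorusLogRep.lean` for one variable (`torusWeight = 1/(1+t²)`, `|1 − e(t)|² = 4t²/(1+t²)`,
`|1 + e(t)|² = 4/(1+t²)`), absolute integrability of `h log V`, `h log (1+t²)`, `h log ((1+t²)/t²)`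
(all from the absolute convergence of Mahler measures, `KZ.integrableOn_torusWeight_mul_log_torusNormSq`),
`ℚ`-semialgebraicity of the rational functions `h, A = (1+t²)/t², B = 1+t², V` and of the sets
`{t ≠ 0}`, `{1 < 3t²}`, … (Bochnak–Coste–Roy 1998, §2.1–2.2). [folklore]
-/

noncomputable section

open MeasureTheory Set Filter MvPolynomial
open Literature.ModelTheory.ExponentialFields (IsSemialgebraic tarski_seidenberg_real_holds
  isSemialgebraic_setOf_eval_lt isSemialgebraic_setOf_eval_le isSemialgebraic_setOf_eval_ne_zero
  isSemialgebraic_setOf_eval_eq_zero isSemialgebraic_univ)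
open Literature.NumberTheory.Transcendental
open Literature.NumberTheory.Transcendental.KZ

namespace Summit.KontsevichZagierPeriods.K2SymbolChains.ClausenPi

/-! ### The one-variable torus data: `h = 1/(1+t²)`, `|1 ∓ e(t)|²` -/

/-- For one variable the torus weight is `h(t) = 1/(1 + t²)` (`dθ/2 = dt/(1+t²)`). [folklore] -/
theorem torusWeight_fin_one (t : Fin 1 → ℝ) : torusWeight t = 1 / (1 + t 0 ^ 2) := by
  rw [torusWeight_def, Fin.prod_univ_one]
  have h : (0 : ℝ) < 1 + t 0 ^ 2 := by positivity
  field_simp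

/-- `|1 − e(t)|² = 4t²/(1 + t²)` (`= 2 − 2 cos θ = 4 sin²(θ/2)`, `t = tan (θ/2)`). [folklore] -/
theorem torusNormSq_one_sub_X (t : Fin 1 → ℝ) :
    torusNormSq (1 - X 0 : MvPolynomial (Fin 1) ℚ) t = 4 * t 0 ^ 2 / (1 + t 0 ^ 2) := by
  have h : (1 + t 0 ^ 2 : ℝ) ≠ 0 := by positivity
  simp [torusNormSq, torusEval_def]
  field_simp
  ring

/-- `|1 + e(t)|² = 4/(1 + t²)` (`= 2 + 2 cos θ = 4 cos²(θ/2)`). [folklore] -/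
theorem torusNormSq_one_add_X (t : Fin 1 → ℝ) :
    torusNormSq (1 + X 0 : MvPolynomial (Fin 1) ℚ) t = 4 / (1 + t 0 ^ 2) := by
  have h : (1 + t 0 ^ 2 : ℝ) ≠ 0 := by positivity
  simp [torusNormSq, torusEval_def]
  field_simp
  ring

/-- `|2|² = 4` on the torus. [folklore] -/
theorem torusNormSq_C_two (t : Fin 1 → ℝ) :
    torusNormSq (C 2 : MvPolynomial (Fin 1) ℚ) t = 4 := by
  simp [torusNormSq, torusEval_def]
  norm_num

/-! ### Integrability on `ℝ¹` -/

/-- `h · log |P(e(t))|²` is integrable on `ℝ¹` for every non-zero `P` (Mahler measures converge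
absolutely; `KZ.integrableOn_torusWeight_mul_log_torusNormSq`). [folklore] -/
theorem integrable_h_mul_log_torusNormSq {P : MvPolynomial (Fin 1) ℚ} (hP : P ≠ 0) :
    Integrable fun t : Fin 1 → ℝ => 1 / (1 + t 0 ^ 2) * Real.log (torusNormSq P t) := by
  have h := integrableOn_torusWeight_mul_log_torusNormSq P
  have huniv : {_x : Fin 1 → ℝ | P ≠ 0} = univ := eq_univ_of_forall fun _ => hP
  rw [huniv, integrableOn_univ] at h
  refine h.congr (ae_of_all _ fun t => ?_)
  simp only [torusWeight_fin_one]

/-- `h · log V`, `V = 4t²/(1+t²) = |1 − e(t)|²`, is integrable on `ℝ¹` (the Clausen integrand).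
[folklore] -/
theorem integrable_h_mul_log_V :
    Integrable fun t : Fin 1 → ℝ => 1 / (1 + t 0 ^ 2) * Real.log (4 * t 0 ^ 2 / (1 + t 0 ^ 2)) := by
  have hP : (1 - X 0 : MvPolynomial (Fin 1) ℚ) ≠ 0 := fun h => by
    simpa using congr_arg constantCoeff h
  simpa only [torusNormSq_one_sub_X] using integrable_h_mul_log_torusNormSq hP

/-- `h · log (4/(1+t²))` is integrable on `ℝ¹`. [folklore] -/
theorem integrable_h_mul_log_W :
    Integrable fun t : Fin 1 → ℝ => 1 / (1 + t 0 ^ 2) * Real.log (4 / (1 + t 0 ^ 2)) := by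
  have hP : (1 + X 0 : MvPolynomial (Fin 1) ℚ) ≠ 0 := fun h => by
    simpa using congr_arg constantCoeff h
  simpa only [torusNormSq_one_add_X] using integrable_h_mul_log_torusNormSq hP

/-- `h = 1/(1+t²)` is integrable on `ℝ¹`. [folklore] -/
theorem integrable_h : Integrable fun t : Fin 1 → ℝ => 1 / (1 + t 0 ^ 2) := by
  have hP : (C 2 : MvPolynomial (Fin 1) ℚ) ≠ 0 := by simp
  have h := (integrable_h_mul_log_torusNormSq hP).div_const (Real.log 4)
  refine h.congr (ae_of_all _ fun t => ?_)
  have h4 : Real.log 4 ≠ 0 := by positivity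
  simp only [torusNormSq_C_two]
  field_simp

/-- `h · log (1 + t²)` is integrable on `ℝ¹`. [folklore] -/
theorem integrable_h_mul_log_B :
    Integrable fun t : Fin 1 → ℝ => 1 / (1 + t 0 ^ 2) * Real.log (1 + t 0 ^ 2) := by
  refine ((integrable_h.mul_const (Real.log 4)).sub integrable_h_mul_log_W).congr
    (ae_of_all _ fun t => ?_)
  have h : (0 : ℝ) < 1 + t 0 ^ 2 := by positivity
  simp only [Pi.sub_apply]
  rw [Real.log_div (by norm_num) h.ne']
  ring

/-- `h · log ((1 + t²)/t²)` is integrable on `{t ≠ 0}`. [folklore] -/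
theorem integrableOn_h_mul_log_A :
    IntegrableOn (fun t : Fin 1 → ℝ => 1 / (1 + t 0 ^ 2) * Real.log ((1 + t 0 ^ 2) / t 0 ^ 2))
      {t | t 0 ≠ 0} := by
  have hm : MeasurableSet {t : Fin 1 → ℝ | t 0 ≠ 0} :=
    (measurableSet_eq_fun (measurable_pi_apply 0) measurable_const).compl
  refine (((integrable_h.mul_const (Real.log 4)).sub integrable_h_mul_log_V).integrableOn.congr_fun
    (fun t ht => ?_) hm)
  have ht0 : (t 0 : ℝ) ≠ 0 := ht
  have h : (0 : ℝ) < 1 + t 0 ^ 2 := by positivity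
  have h2 : (0 : ℝ) < t 0 ^ 2 := by positivity
  simp only [Pi.sub_apply]
  rw [Real.log_div h.ne' h2.ne', Real.log_div (by positivity) h.ne', Real.log_mul (by norm_num) h2.ne']
  ring

/-! ### Semialgebraic atoms on `ℝ¹` -/

/-- `h = 1/(1 + t²)` is `ℚ`-semialgebraic (a rational function). [BCR 1998, §2.2] [folklore] -/
theorem isSemialgebraicFunOn_h {S : Set (Fin 1 → ℝ)} (hS : IsSemialgebraic ℚ S) :
    IsSemialgebraicFunOn ℚ S fun x => 1 / (1 + x 0 ^ 2) := by
  refine (isSemialgebraicFunOn_aeval_div_aeval hS 1 (1 + X 0 ^ 2) fun x _ => ?_).congr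
    fun x _ => by simp
  have : (0 : ℝ) < 1 + x 0 ^ 2 := by positivity
  simpa using this.ne'

/-- `h/2 = 1/(2(1 + t²))` is `ℚ`-semialgebraic. [BCR 1998, §2.2] [folklore] -/
theorem isSemialgebraicFunOn_h_half {S : Set (Fin 1 → ℝ)} (hS : IsSemialgebraic ℚ S) :
    IsSemialgebraicFunOn ℚ S fun x => 1 / (1 + x 0 ^ 2) / 2 := by
  refine (isSemialgebraicFunOn_aeval_div_aeval hS 1 (C 2 * (1 + X 0 ^ 2)) fun x _ => ?_).congr
    fun x _ => ?_
  · have : (0 : ℝ) < 1 + x 0 ^ 2 := by positivity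
    simp [this.ne']
  · have : (0 : ℝ) < 1 + x 0 ^ 2 := by positivity
    simp only [map_one, map_mul, MvPolynomial.aeval_C, map_add, map_pow, MvPolynomial.aeval_X,
      eq_ratCast, Rat.cast_ofNat]
    field_simp

/-- `B = 1 + t²` is `ℚ`-semialgebraic (a polynomial). [BCR 1998, §2.2] [folklore] -/
theorem isSemialgebraicFunOn_B {S : Set (Fin 1 → ℝ)} (hS : IsSemialgebraic ℚ S) :
    IsSemialgebraicFunOn ℚ S fun x => 1 + x 0 ^ 2 :=
  (isSemialgebraicFunOn_aeval hS (1 + X 0 ^ 2)).congr fun x _ => by simp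

/-- `A = (1 + t²)/t²` is `ℚ`-semialgebraic off `t = 0`. [BCR 1998, §2.2] [folklore] -/
theorem isSemialgebraicFunOn_A {S : Set (Fin 1 → ℝ)} (hS : IsSemialgebraic ℚ S)
    (h0 : ∀ x ∈ S, x 0 ≠ 0) : IsSemialgebraicFunOn ℚ S fun x => (1 + x 0 ^ 2) / x 0 ^ 2 :=
  (isSemialgebraicFunOn_aeval_div_aeval hS (1 + X 0 ^ 2) (X 0 ^ 2) fun x hx => by
    simpa using h0 x hx).congr fun x _ => by simp

/-- `V = 4t²/(1 + t²)` is `ℚ`-semialgebraic. [BCR 1998, §2.2] [folklore] -/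
theorem isSemialgebraicFunOn_V {S : Set (Fin 1 → ℝ)} (hS : IsSemialgebraic ℚ S) :
    IsSemialgebraicFunOn ℚ S fun x => 4 * x 0 ^ 2 / (1 + x 0 ^ 2) := by
  refine (isSemialgebraicFunOn_aeval_div_aeval hS (C 4 * X 0 ^ 2) (1 + X 0 ^ 2) fun x _ => ?_).congr
    fun x _ => ?_
  · have : (0 : ℝ) < 1 + x 0 ^ 2 := by positivity
    simpa using this.ne'
  · simp only [map_one, map_mul, MvPolynomial.aeval_C, map_add, map_pow, MvPolynomial.aeval_X,
      eq_ratCast, Rat.cast_ofNat]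

/-- Natural-number constants are `ℚ`-semialgebraic functions. [BCR 1998, §2.2] [folklore] -/
theorem isSemialgebraicFunOn_four {m : ℕ} {S : Set (Fin m → ℝ)} (hS : IsSemialgebraic ℚ S) :
    IsSemialgebraicFunOn ℚ S fun _ => (4 : ℝ) := by
  simpa using isSemialgebraicFunOn_natCast hS 4

/-- The constant `1` is a `ℚ`-semialgebraic function. [BCR 1998, §2.2] [folklore] -/
theorem isSemialgebraicFunOn_one {m : ℕ} {S : Set (Fin m → ℝ)} (hS : IsSemialgebraic ℚ S) :
    IsSemialgebraicFunOn ℚ S fun _ => (1 : ℝ) := by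
  simpa using isSemialgebraicFunOn_natCast hS 1

/-- `{t ≠ 0} ⊆ ℝ¹` is `ℚ`-semialgebraic. [BCR 1998, §2.1] [folklore] -/
theorem isSemialgebraic_ne_zero : IsSemialgebraic ℚ {x : Fin 1 → ℝ | x 0 ≠ 0} := by
  have h := isSemialgebraic_setOf_eval_ne_zero (k := ℚ) (R := ℝ) (X 0 : MvPolynomial (Fin 1) ℚ)
  simp only [aeval_X] at h
  exact h

/-- `{q < p t²} ⊆ ℝ¹` (`p, q ∈ ℕ`) is `ℚ`-semialgebraic. [BCR 1998, §2.1] [folklore] -/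
theorem isSemialgebraic_lt_sq (p q : ℕ) :
    IsSemialgebraic ℚ {x : Fin 1 → ℝ | (q : ℝ) < p * x 0 ^ 2} := by
  have h := isSemialgebraic_setOf_eval_lt (k := ℚ) (R := ℝ)
    (q : MvPolynomial (Fin 1) ℚ) ((p : MvPolynomial (Fin 1) ℚ) * X 0 ^ 2)
  simp only [map_natCast, map_mul, map_pow, aeval_X] at h
  exact h

/-- `{p t² < q} ⊆ ℝ¹` (`p, q ∈ ℕ`) is `ℚ`-semialgebraic. [BCR 1998, §2.1] [folklore] -/
theorem isSemialgebraic_sq_lt (p q : ℕ) :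
    IsSemialgebraic ℚ {x : Fin 1 → ℝ | (p : ℝ) * x 0 ^ 2 < q} := by
  have h := isSemialgebraic_setOf_eval_lt (k := ℚ) (R := ℝ)
    ((p : MvPolynomial (Fin 1) ℚ) * X 0 ^ 2) (q : MvPolynomial (Fin 1) ℚ)
  simp only [map_natCast, map_mul, map_pow, aeval_X] at h
  exact h

/-- `{q ≤ p t²} ⊆ ℝ¹` (`p, q ∈ ℕ`) is `ℚ`-semialgebraic. [BCR 1998, §2.1] [folklore] -/
theorem isSemialgebraic_le_sq (p q : ℕ) :
    IsSemialgebraic ℚ {x : Fin 1 → ℝ | (q : ℝ) ≤ p * x 0 ^ 2} := by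
  have h := isSemialgebraic_setOf_eval_le (k := ℚ) (R := ℝ)
    (q : MvPolynomial (Fin 1) ℚ) ((p : MvPolynomial (Fin 1) ℚ) * X 0 ^ 2)
  simp only [map_natCast, map_mul, map_pow, aeval_X] at h
  exact h

/-- `{1 < 3t²}` is `ℚ`-semialgebraic. [BCR 1998, §2.1] [folklore] -/
theorem isSemialgebraic_one_lt_three_sq : IsSemialgebraic ℚ {x : Fin 1 → ℝ | (1 : ℝ) < 3 * x 0 ^ 2} := by
  have h := isSemialgebraic_lt_sq 3 1
  simp only [Nat.cast_ofNat, Nat.cast_one] at h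
  exact h

/-- `{3t² < 1}` is `ℚ`-semialgebraic. [BCR 1998, §2.1] [folklore] -/
theorem isSemialgebraic_three_sq_lt_one : IsSemialgebraic ℚ {x : Fin 1 → ℝ | 3 * x 0 ^ 2 < (1 : ℝ)} := by
  have h := isSemialgebraic_sq_lt 3 1
  simp only [Nat.cast_ofNat, Nat.cast_one] at h
  exact h

/-- `{1 ≤ 3t²}` is `ℚ`-semialgebraic. [BCR 1998, §2.1] [folklore] -/
theorem isSemialgebraic_one_le_three_sq : IsSemialgebraic ℚ {x : Fin 1 → ℝ | (1 : ℝ) ≤ 3 * x 0 ^ 2} := by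
  have h := isSemialgebraic_le_sq 3 1
  simp only [Nat.cast_ofNat, Nat.cast_one] at h
  exact h

/-- `{t² < 1}` is `ℚ`-semialgebraic. [BCR 1998, §2.1] [folklore] -/
theorem isSemialgebraic_sq_lt_one : IsSemialgebraic ℚ {x : Fin 1 → ℝ | x 0 ^ 2 < (1 : ℝ)} := by
  have h := isSemialgebraic_sq_lt 1 1
  simp only [Nat.cast_one, one_mul] at h
  exact h

/-- `{1 < t²}` is `ℚ`-semialgebraic. [BCR 1998, §2.1] [folklore] -/
theorem isSemialgebraic_one_lt_sq : IsSemialgebraic ℚ {x : Fin 1 → ℝ | (1 : ℝ) < x 0 ^ 2} := by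
  have h := isSemialgebraic_lt_sq 1 1
  simp only [Nat.cast_one, one_mul] at h
  exact h

end Summit.KontsevichZagierPeriods.K2SymbolChains.ClausenPi
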